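import Summits.Ventures.YMGap.RobustBall.OneStateStarSU3
import Summits.Ventures.YMGap.RobustBall.MassGapOnBallZdGRowsSU3Certified
import HarnessLib

/-!
# Venture YMGap, track ROBUST-BALL (Y2) — ONE STATE for `SU(3)` on `ℤ⁴` GIVEN H1, H2: the unique DLR state of every member
# of the gauge-invariant tier-1 ball is its periodised torus limit, massive AND area-law, at the CERTIFIED-STAR cells up to `β_W = 11/20`

HONEST FRAMING. WHAT THIS IS: a venture file (cell `pub-ymgap`, track Y2 ROBUST-BALL, seat engine-2 (g8); 0 compute): ds-3's
ONE-STATE theorem `oneState_onBallZdG` (`OneState.lean`; hypothesis-free `SU(3)` cells in `OneStateStarSU3.lean`) fed with THIS seat's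
`SU(3)` CERTIFIED-STAR rows on `ℤ⁴` (`MassGapOnBallZdGRowsSU3Certified.lean`: ds-2's robust vertex-star door on `ℤ^d` × the cell's
certified one-link modulus `K = 7/5`) and with engine-2's CONDITIONAL affine area-law radius on the pair slab door
(`RobustBallPair.su3_areaLawOnBall_affineRadius`: GIVEN H1, H2, `AreaLawOnBall 3 4 (β_W/3) (2ε_AL) ε_AL r mv` with
`ε_AL(β_W) = 0.47 − β_W/2` on `0 ≤ β_W ≤ 11/20`, whose ball contains every star cell below: `ε_AL ≥ 0.195 > 0.103`).
BOTH inputs are conditional on the SAME two displayed hypotheses H1 `OneLinkPoincareSUN 3 (3/5) (4/5)` and H2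
`OneLinkVarianceBound 3 (11/30) (49/20)` (finite-dimensional, two-engine certified, NOT proved here; class «K × C-iv»).
CELLS (`SU(3)`, `d = 4`, Wilson `β_W`, gauge-invariant tier-1 ball `MemBallZdG (2ε) ε R`, 't Hooft coupling `β_W/9`):
(1 / 4, .103) (3 / 10, .083) (1 / 3, .070) (2 / 5, .048) (9 / 20, .033) (1 / 2, .019) (11 / 20, .007): GIVEN H1, H2, for every member ONE probability measure is at once the unique DLR
state and the infinite-volume limit of the member's PERIODISED torus states; it is an Osterwalder–Seiler massive state with
plaquette–plaquette decay AND obeys Wilson's area law; for each range `R` one pair `(C, c)`, `c > 0`, serves every member of range `≤ R`.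
WHAT MOVES: ds-3's hypothesis-free `SU(3)` one-state cells stop at (1/4, .019) (eigen modulus); GIVEN H1, H2 the one-state reading
now reaches the radius cap `β_W = 11/20` of the certificates.  WHAT IT IS NOT: not hypothesis-free; existence of the string tension
is not claimed; radii are door artefacts; strong-coupling lattice statements; nothing about the continuum limit or the Clay
Millennium problem.

References: ds-3 `OneState.lean` / `OneStateStarSU3.lean`; this seat `MassGapOnBallZdGRowsSU3Certified.lean`, `AreaLawRadiusPair.lean` §3.
-/

noncomputable section

open MeasureTheory Filter Topology Function Finset
open scoped NNReal
open Literature.Probability.LatticeModels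
open Literature.MathematicalPhysics.QuantumLattice hiding torusNorm
open Literature.MathematicalPhysics.QuantumFieldTheory hiding ZdEdge Site
open Literature.Barriers.QuantumFields (IsMassiveState)
open Summit.QuantumFields.BalabanUV.InfraRed.StrongCouplingPoincareDoorSUN (OneLinkPoincareSUN)
open Summit.QuantumFields.BalabanUV.InfraRed.StrongCouplingVarianceDoorSUN (OneLinkVarianceBound)
open Summit.Ventures.YMGap.RobustBallPair (su3_areaLawOnBall_affineRadius)

namespace Summit.Ventures.YMGap.RobustBall

/-- **`SU(3)`, `d = 4` ONE-STATE SCHEMA GIVEN H1, H2**: a `MassGapOnBallZdG 4 3 (β_W/9) ε₀ ε₁ R` row at Wilson `0 ≤ β_W ≤ 11/20` with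
radii inside the conditional affine area-law ball `(2ε_AL(β_W), ε_AL(β_W))`, `ε_AL(β_W) = 0.47 − β_W/2` (pair slab door on P11), gives: for
each range `R` one `(C, c)`, `c > 0`, such that every member of `MemBallZdG ε₀ ε₁ R` has ONE state, massive with plaquette–plaquette
decay and `HasAreaLawWith μ χ₃ C c`. [folklore] -/
theorem su3_oneState_of_certifiedStar_row (hP : OneLinkPoincareSUN 3 (3 / 5) (4 / 5))
    (hV : OneLinkVarianceBound 3 (11 / 30) (49 / 20)) {βW ε₀ ε₁ : ℝ} {R : ℕ} (hε₀ : 0 ≤ ε₀) (hε₁ : 0 ≤ ε₁) (hβ0 : 0 ≤ βW)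
    (hβ : βW ≤ 11 / 20) (h₀ : ε₀ ≤ 2 * (47 / 100 - βW / 2)) (h₁ : ε₁ ≤ 47 / 100 - βW / 2)
    (hgap : MassGapOnBallZdG 4 3 (βW / 9) ε₀ ε₁ R) :
    ∃ C c : ℝ, 0 < c ∧ ∀ (W : Potential (ZdEdge 4) (SUN 3)) (supp : Finset (ZdEdge 4) → Finset (Finset (ZdEdge 4)))
      (hmem : MemBallZdG ε₀ ε₁ R W supp) (hdep : ∀ X, DependsOn (W X) (↑X : Set (ZdEdge 4)))
      (hg : ∀ X, IsZdGaugeInvariant (W X)) (hm : ∀ X, Measurable (W X)) (hb : ∀ X, ∃ C, ∀ U, |W X U| ≤ C),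
      ∃ μ : Measure (LGConfig 4 (SUN 3)),
        perturbedGibbsMeasures (d := 4) (fundamentalRep (Fin 3)) (((3 : ℕ) : ℝ) * (βW / 9)) W supp = {μ} ∧
        perturbedLimitPoints (((3 : ℕ) : ℝ) * (βW / 9)) (periodisedFamily W supp hdep hg hm hb) = {μ} ∧
        IsMassiveState μ ∧ HasExponentialDecay (plaquetteCorrFn (fundamentalRep (Fin 3)) μ) ∧
        HasAreaLawWith μ (fun g => normalisedCharacter 3 (fundamentalRep (Fin 3) g)) C c := by
  have hA := su3_areaLawOnBall_affineRadius hP hV hβ0 hβ R (mv := 2 * R + 1) (by omega)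
  have e : βW / 3 = ((3 : ℕ) : ℝ) * (βW / 9) := by push_cast; ring
  rw [e] at hA
  exact oneState_onBallZdG (N := 3) (by norm_num) hε₀ hε₁ hgap (hA.anti h₀ h₁ le_rfl le_rfl)


/-! ### Cells by name (GIVEN H1, H2) -/

/-- **`SU(3)`, `ℤ⁴`, `β_W = 1 / 4`, GIVEN H1, H2**: every member of the gauge-invariant tier-1 ball `MemBallZdG (103 / 500) (103 / 1000) R`
(oscillation load `≤ 0.206`, site-incidence Lipschitz load `≤ 0.103`, range `R`) added to `SU(3)` Wilson at `β_W = 1 / 4`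
('t Hooft `1 / 36`, tree `1 / 12`) has ONE state — the unique DLR state = the infinite-volume limit of its PERIODISED torus states —
massive with plaquette–plaquette decay AND area-law, for each `R` one `(C, c)` (this seat's `su3_massGapOnBallZdG_certifiedStar_oneQuarter` ×
`su3_areaLawOnBall_affineRadius`). Class K × C-iv (H1/H2 displayed). [folklore] -/
theorem su3_oneState_certifiedStar_oneQuarter (hP : OneLinkPoincareSUN 3 (3 / 5) (4 / 5))
    (hV : OneLinkVarianceBound 3 (11 / 30) (49 / 20)) (R : ℕ) :
    ∃ C c : ℝ, 0 < c ∧ ∀ (W : Potential (ZdEdge 4) (SUN 3)) (supp : Finset (ZdEdge 4) → Finset (Finset (ZdEdge 4)))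
      (hmem : MemBallZdG (103 / 500) (103 / 1000) R W supp) (hdep : ∀ X, DependsOn (W X) (↑X : Set (ZdEdge 4)))
      (hg : ∀ X, IsZdGaugeInvariant (W X)) (hm : ∀ X, Measurable (W X)) (hb : ∀ X, ∃ C, ∀ U, |W X U| ≤ C),
      ∃ μ : Measure (LGConfig 4 (SUN 3)),
        perturbedGibbsMeasures (d := 4) (fundamentalRep (Fin 3)) (((3 : ℕ) : ℝ) * ((1 / 4 : ℝ) / 9)) W supp = {μ} ∧
        perturbedLimitPoints (((3 : ℕ) : ℝ) * ((1 / 4 : ℝ) / 9)) (periodisedFamily W supp hdep hg hm hb) = {μ} ∧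
        IsMassiveState μ ∧ HasExponentialDecay (plaquetteCorrFn (fundamentalRep (Fin 3)) μ) ∧
        HasAreaLawWith μ (fun g => normalisedCharacter 3 (fundamentalRep (Fin 3) g)) C c := by
  have hgap : MassGapOnBallZdG 4 3 ((1 / 4 : ℝ) / 9) (103 / 500) (103 / 1000) R := by
    have h := su3_massGapOnBallZdG_certifiedStar_oneQuarter hP hV R; norm_num at h ⊢; exact h
  exact su3_oneState_of_certifiedStar_row hP hV (by norm_num) (by norm_num) (by norm_num) (by norm_num) (by norm_num)
    (by norm_num) hgap

/-- **`SU(3)`, `ℤ⁴`, `β_W = 3 / 10`, GIVEN H1, H2**: every member of the gauge-invariant tier-1 ball `MemBallZdG (83 / 500) (83 / 1000) R`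
(oscillation load `≤ 0.166`, site-incidence Lipschitz load `≤ 0.083`, range `R`) added to `SU(3)` Wilson at `β_W = 3 / 10`
('t Hooft `1 / 30`, tree `1 / 10`) has ONE state — the unique DLR state = the infinite-volume limit of its PERIODISED torus states —
massive with plaquette–plaquette decay AND area-law, for each `R` one `(C, c)` (this seat's `su3_massGapOnBallZdG_certifiedStar_threeTenths` ×
`su3_areaLawOnBall_affineRadius`). Class K × C-iv (H1/H2 displayed). [folklore] -/
theorem su3_oneState_certifiedStar_threeTenths (hP : OneLinkPoincareSUN 3 (3 / 5) (4 / 5))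
    (hV : OneLinkVarianceBound 3 (11 / 30) (49 / 20)) (R : ℕ) :
    ∃ C c : ℝ, 0 < c ∧ ∀ (W : Potential (ZdEdge 4) (SUN 3)) (supp : Finset (ZdEdge 4) → Finset (Finset (ZdEdge 4)))
      (hmem : MemBallZdG (83 / 500) (83 / 1000) R W supp) (hdep : ∀ X, DependsOn (W X) (↑X : Set (ZdEdge 4)))
      (hg : ∀ X, IsZdGaugeInvariant (W X)) (hm : ∀ X, Measurable (W X)) (hb : ∀ X, ∃ C, ∀ U, |W X U| ≤ C),
      ∃ μ : Measure (LGConfig 4 (SUN 3)),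
        perturbedGibbsMeasures (d := 4) (fundamentalRep (Fin 3)) (((3 : ℕ) : ℝ) * ((3 / 10 : ℝ) / 9)) W supp = {μ} ∧
        perturbedLimitPoints (((3 : ℕ) : ℝ) * ((3 / 10 : ℝ) / 9)) (periodisedFamily W supp hdep hg hm hb) = {μ} ∧
        IsMassiveState μ ∧ HasExponentialDecay (plaquetteCorrFn (fundamentalRep (Fin 3)) μ) ∧
        HasAreaLawWith μ (fun g => normalisedCharacter 3 (fundamentalRep (Fin 3) g)) C c := by
  have hgap : MassGapOnBallZdG 4 3 ((3 / 10 : ℝ) / 9) (83 / 500) (83 / 1000) R := by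
    have h := su3_massGapOnBallZdG_certifiedStar_threeTenths hP hV R; norm_num at h ⊢; exact h
  exact su3_oneState_of_certifiedStar_row hP hV (by norm_num) (by norm_num) (by norm_num) (by norm_num) (by norm_num)
    (by norm_num) hgap

/-- **`SU(3)`, `ℤ⁴`, `β_W = 1 / 3`, GIVEN H1, H2**: every member of the gauge-invariant tier-1 ball `MemBallZdG (7 / 50) (7 / 100) R`
(oscillation load `≤ 0.140`, site-incidence Lipschitz load `≤ 0.070`, range `R`) added to `SU(3)` Wilson at `β_W = 1 / 3`
('t Hooft `1 / 27`, tree `1 / 9`) has ONE state — the unique DLR state = the infinite-volume limit of its PERIODISED torus states —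
massive with plaquette–plaquette decay AND area-law, for each `R` one `(C, c)` (this seat's `su3_massGapOnBallZdG_certifiedStar_oneThird` ×
`su3_areaLawOnBall_affineRadius`). Class K × C-iv (H1/H2 displayed). [folklore] -/
theorem su3_oneState_certifiedStar_oneThird (hP : OneLinkPoincareSUN 3 (3 / 5) (4 / 5))
    (hV : OneLinkVarianceBound 3 (11 / 30) (49 / 20)) (R : ℕ) :
    ∃ C c : ℝ, 0 < c ∧ ∀ (W : Potential (ZdEdge 4) (SUN 3)) (supp : Finset (ZdEdge 4) → Finset (Finset (ZdEdge 4)))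
      (hmem : MemBallZdG (7 / 50) (7 / 100) R W supp) (hdep : ∀ X, DependsOn (W X) (↑X : Set (ZdEdge 4)))
      (hg : ∀ X, IsZdGaugeInvariant (W X)) (hm : ∀ X, Measurable (W X)) (hb : ∀ X, ∃ C, ∀ U, |W X U| ≤ C),
      ∃ μ : Measure (LGConfig 4 (SUN 3)),
        perturbedGibbsMeasures (d := 4) (fundamentalRep (Fin 3)) (((3 : ℕ) : ℝ) * ((1 / 3 : ℝ) / 9)) W supp = {μ} ∧
        perturbedLimitPoints (((3 : ℕ) : ℝ) * ((1 / 3 : ℝ) / 9)) (periodisedFamily W supp hdep hg hm hb) = {μ} ∧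
        IsMassiveState μ ∧ HasExponentialDecay (plaquetteCorrFn (fundamentalRep (Fin 3)) μ) ∧
        HasAreaLawWith μ (fun g => normalisedCharacter 3 (fundamentalRep (Fin 3) g)) C c := by
  have hgap : MassGapOnBallZdG 4 3 ((1 / 3 : ℝ) / 9) (7 / 50) (7 / 100) R := by
    have h := su3_massGapOnBallZdG_certifiedStar_oneThird hP hV R; norm_num at h ⊢; exact h
  exact su3_oneState_of_certifiedStar_row hP hV (by norm_num) (by norm_num) (by norm_num) (by norm_num) (by norm_num)
    (by norm_num) hgap

/-- **`SU(3)`, `ℤ⁴`, `β_W = 2 / 5`, GIVEN H1, H2**: every member of the gauge-invariant tier-1 ball `MemBallZdG (12 / 125) (6 / 125) R`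
(oscillation load `≤ 0.096`, site-incidence Lipschitz load `≤ 0.048`, range `R`) added to `SU(3)` Wilson at `β_W = 2 / 5`
('t Hooft `2 / 45`, tree `2 / 15`) has ONE state — the unique DLR state = the infinite-volume limit of its PERIODISED torus states —
massive with plaquette–plaquette decay AND area-law, for each `R` one `(C, c)` (this seat's `su3_massGapOnBallZdG_certifiedStar_twoFifths` ×
`su3_areaLawOnBall_affineRadius`). Class K × C-iv (H1/H2 displayed). [folklore] -/
theorem su3_oneState_certifiedStar_twoFifths (hP : OneLinkPoincareSUN 3 (3 / 5) (4 / 5))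
    (hV : OneLinkVarianceBound 3 (11 / 30) (49 / 20)) (R : ℕ) :
    ∃ C c : ℝ, 0 < c ∧ ∀ (W : Potential (ZdEdge 4) (SUN 3)) (supp : Finset (ZdEdge 4) → Finset (Finset (ZdEdge 4)))
      (hmem : MemBallZdG (12 / 125) (6 / 125) R W supp) (hdep : ∀ X, DependsOn (W X) (↑X : Set (ZdEdge 4)))
      (hg : ∀ X, IsZdGaugeInvariant (W X)) (hm : ∀ X, Measurable (W X)) (hb : ∀ X, ∃ C, ∀ U, |W X U| ≤ C),
      ∃ μ : Measure (LGConfig 4 (SUN 3)),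
        perturbedGibbsMeasures (d := 4) (fundamentalRep (Fin 3)) (((3 : ℕ) : ℝ) * ((2 / 5 : ℝ) / 9)) W supp = {μ} ∧
        perturbedLimitPoints (((3 : ℕ) : ℝ) * ((2 / 5 : ℝ) / 9)) (periodisedFamily W supp hdep hg hm hb) = {μ} ∧
        IsMassiveState μ ∧ HasExponentialDecay (plaquetteCorrFn (fundamentalRep (Fin 3)) μ) ∧
        HasAreaLawWith μ (fun g => normalisedCharacter 3 (fundamentalRep (Fin 3) g)) C c := by
  have hgap : MassGapOnBallZdG 4 3 ((2 / 5 : ℝ) / 9) (12 / 125) (6 / 125) R := by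
    have h := su3_massGapOnBallZdG_certifiedStar_twoFifths hP hV R; norm_num at h ⊢; exact h
  exact su3_oneState_of_certifiedStar_row hP hV (by norm_num) (by norm_num) (by norm_num) (by norm_num) (by norm_num)
    (by norm_num) hgap

/-- **`SU(3)`, `ℤ⁴`, `β_W = 9 / 20`, GIVEN H1, H2**: every member of the gauge-invariant tier-1 ball `MemBallZdG (33 / 500) (33 / 1000) R`
(oscillation load `≤ 0.066`, site-incidence Lipschitz load `≤ 0.033`, range `R`) added to `SU(3)` Wilson at `β_W = 9 / 20`
('t Hooft `1 / 20`, tree `3 / 20`) has ONE state — the unique DLR state = the infinite-volume limit of its PERIODISED torus states —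
massive with plaquette–plaquette decay AND area-law, for each `R` one `(C, c)` (this seat's `su3_massGapOnBallZdG_certifiedStar_nineTwentieths` ×
`su3_areaLawOnBall_affineRadius`). Class K × C-iv (H1/H2 displayed). [folklore] -/
theorem su3_oneState_certifiedStar_nineTwentieths (hP : OneLinkPoincareSUN 3 (3 / 5) (4 / 5))
    (hV : OneLinkVarianceBound 3 (11 / 30) (49 / 20)) (R : ℕ) :
    ∃ C c : ℝ, 0 < c ∧ ∀ (W : Potential (ZdEdge 4) (SUN 3)) (supp : Finset (ZdEdge 4) → Finset (Finset (ZdEdge 4)))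
      (hmem : MemBallZdG (33 / 500) (33 / 1000) R W supp) (hdep : ∀ X, DependsOn (W X) (↑X : Set (ZdEdge 4)))
      (hg : ∀ X, IsZdGaugeInvariant (W X)) (hm : ∀ X, Measurable (W X)) (hb : ∀ X, ∃ C, ∀ U, |W X U| ≤ C),
      ∃ μ : Measure (LGConfig 4 (SUN 3)),
        perturbedGibbsMeasures (d := 4) (fundamentalRep (Fin 3)) (((3 : ℕ) : ℝ) * ((9 / 20 : ℝ) / 9)) W supp = {μ} ∧
        perturbedLimitPoints (((3 : ℕ) : ℝ) * ((9 / 20 : ℝ) / 9)) (periodisedFamily W supp hdep hg hm hb) = {μ} ∧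
        IsMassiveState μ ∧ HasExponentialDecay (plaquetteCorrFn (fundamentalRep (Fin 3)) μ) ∧
        HasAreaLawWith μ (fun g => normalisedCharacter 3 (fundamentalRep (Fin 3) g)) C c := by
  have hgap : MassGapOnBallZdG 4 3 ((9 / 20 : ℝ) / 9) (33 / 500) (33 / 1000) R := by
    have h := su3_massGapOnBallZdG_certifiedStar_nineTwentieths hP hV R; norm_num at h ⊢; exact h
  exact su3_oneState_of_certifiedStar_row hP hV (by norm_num) (by norm_num) (by norm_num) (by norm_num) (by norm_num)
    (by norm_num) hgap

/-- **`SU(3)`, `ℤ⁴`, `β_W = 1 / 2`, GIVEN H1, H2**: every member of the gauge-invariant tier-1 ball `MemBallZdG (19 / 500) (19 / 1000) R`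
(oscillation load `≤ 0.038`, site-incidence Lipschitz load `≤ 0.019`, range `R`) added to `SU(3)` Wilson at `β_W = 1 / 2`
('t Hooft `1 / 18`, tree `1 / 6`) has ONE state — the unique DLR state = the infinite-volume limit of its PERIODISED torus states —
massive with plaquette–plaquette decay AND area-law, for each `R` one `(C, c)` (this seat's `su3_massGapOnBallZdG_certifiedStar_oneHalf` ×
`su3_areaLawOnBall_affineRadius`). Class K × C-iv (H1/H2 displayed). [folklore] -/
theorem su3_oneState_certifiedStar_oneHalf (hP : OneLinkPoincareSUN 3 (3 / 5) (4 / 5))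
    (hV : OneLinkVarianceBound 3 (11 / 30) (49 / 20)) (R : ℕ) :
    ∃ C c : ℝ, 0 < c ∧ ∀ (W : Potential (ZdEdge 4) (SUN 3)) (supp : Finset (ZdEdge 4) → Finset (Finset (ZdEdge 4)))
      (hmem : MemBallZdG (19 / 500) (19 / 1000) R W supp) (hdep : ∀ X, DependsOn (W X) (↑X : Set (ZdEdge 4)))
      (hg : ∀ X, IsZdGaugeInvariant (W X)) (hm : ∀ X, Measurable (W X)) (hb : ∀ X, ∃ C, ∀ U, |W X U| ≤ C),
      ∃ μ : Measure (LGConfig 4 (SUN 3)),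
        perturbedGibbsMeasures (d := 4) (fundamentalRep (Fin 3)) (((3 : ℕ) : ℝ) * ((1 / 2 : ℝ) / 9)) W supp = {μ} ∧
        perturbedLimitPoints (((3 : ℕ) : ℝ) * ((1 / 2 : ℝ) / 9)) (periodisedFamily W supp hdep hg hm hb) = {μ} ∧
        IsMassiveState μ ∧ HasExponentialDecay (plaquetteCorrFn (fundamentalRep (Fin 3)) μ) ∧
        HasAreaLawWith μ (fun g => normalisedCharacter 3 (fundamentalRep (Fin 3) g)) C c := by
  have hgap : MassGapOnBallZdG 4 3 ((1 / 2 : ℝ) / 9) (19 / 500) (19 / 1000) R := by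
    have h := su3_massGapOnBallZdG_certifiedStar_oneHalf hP hV R; norm_num at h ⊢; exact h
  exact su3_oneState_of_certifiedStar_row hP hV (by norm_num) (by norm_num) (by norm_num) (by norm_num) (by norm_num)
    (by norm_num) hgap

/-- **`SU(3)`, `ℤ⁴`, `β_W = 11 / 20`, GIVEN H1, H2**: every member of the gauge-invariant tier-1 ball `MemBallZdG (7 / 500) (7 / 1000) R`
(oscillation load `≤ 0.014`, site-incidence Lipschitz load `≤ 0.007`, range `R`) added to `SU(3)` Wilson at `β_W = 11 / 20`
('t Hooft `11 / 180`, tree `11 / 60`) has ONE state — the unique DLR state = the infinite-volume limit of its PERIODISED torus states —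
massive with plaquette–plaquette decay AND area-law, for each `R` one `(C, c)` (this seat's `su3_massGapOnBallZdG_certifiedStar_elevenTwentieths` ×
`su3_areaLawOnBall_affineRadius`). Class K × C-iv (H1/H2 displayed). [folklore] -/
theorem su3_oneState_certifiedStar_elevenTwentieths (hP : OneLinkPoincareSUN 3 (3 / 5) (4 / 5))
    (hV : OneLinkVarianceBound 3 (11 / 30) (49 / 20)) (R : ℕ) :
    ∃ C c : ℝ, 0 < c ∧ ∀ (W : Potential (ZdEdge 4) (SUN 3)) (supp : Finset (ZdEdge 4) → Finset (Finset (ZdEdge 4)))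
      (hmem : MemBallZdG (7 / 500) (7 / 1000) R W supp) (hdep : ∀ X, DependsOn (W X) (↑X : Set (ZdEdge 4)))
      (hg : ∀ X, IsZdGaugeInvariant (W X)) (hm : ∀ X, Measurable (W X)) (hb : ∀ X, ∃ C, ∀ U, |W X U| ≤ C),
      ∃ μ : Measure (LGConfig 4 (SUN 3)),
        perturbedGibbsMeasures (d := 4) (fundamentalRep (Fin 3)) (((3 : ℕ) : ℝ) * ((11 / 20 : ℝ) / 9)) W supp = {μ} ∧
        perturbedLimitPoints (((3 : ℕ) : ℝ) * ((11 / 20 : ℝ) / 9)) (periodisedFamily W supp hdep hg hm hb) = {μ} ∧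
        IsMassiveState μ ∧ HasExponentialDecay (plaquetteCorrFn (fundamentalRep (Fin 3)) μ) ∧
        HasAreaLawWith μ (fun g => normalisedCharacter 3 (fundamentalRep (Fin 3) g)) C c := by
  have hgap : MassGapOnBallZdG 4 3 ((11 / 20 : ℝ) / 9) (7 / 500) (7 / 1000) R := by
    have h := su3_massGapOnBallZdG_certifiedStar_elevenTwentieths hP hV R; norm_num at h ⊢; exact h
  exact su3_oneState_of_certifiedStar_row hP hV (by norm_num) (by norm_num) (by norm_num) (by norm_num) (by norm_num)
    (by norm_num) hgap

end Summit.Ventures.YMGap.RobustBall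

end
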